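import Summits.KontsevichZagierPeriods.KontsevichZagierPeriods.Theses.DessinsDimensionOne
import Literature.NumberTheory.Transcendental.KZRelationsLE

/-!
# Line `volume_transfer` — skeleton for the piece `DimensionStep` (stmt-KontsevichZagierPeriods-18965)
# of the BC2 split of `DessinsDimensionOne.ExcursionBudget` (stmt-KontsevichZagierPeriods-6259)

`DimensionStep`: for `d ≥ 2`, layer `d` of `ExcursionBudget` (KZ-rational representations of
dimensions `≤ d` with equal values differ by an element of `relations_≤(d+1)`) implies Conjecture 1
on the stratum `≤ d + 1`.

Line: VOLUME TRANSFER ONE DIMENSION UP ("conditional Hilbert's third problem for bounded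
`ℚ`-semialgebraic solids in `ℝ^{d+2}`, inside KZ's calculus"). The reduction half is PROVED in the
tree (`KZ.exists_sub_isBounded`, `KZVolumeConjectureProofs.lean`: every representation of dimension
`n` is, modulo the moves, a difference `[A] − [B]` of two BOUNDED volume representations of
dimension `n + 1` — Viu-Sos 2021 Cor. 2.3 with a resolution-free tree proof), so the open content of
the step is isolated in its volume form, under the inductive hypothesis:

* `stub_boundedVolumes` — every representation of dimension `n` is KZ-equivalent to a difference of
  two bounded volume representations of each dimension `N ≥ n + 1` (`KZ.exists_sub_isBounded`, then
  raise both solids by unit slabs `K × [j, j+1]`, one Newton–Leibniz move each,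
  `KZ.IntegralRep.equivalent_slab`; bounded stays bounded, integrand `1` stays `1`). Provable now, M.
* `stub_volumeStep` — THE OPEN CONTENT, conditional and dimension-local: for `d ≥ 2`, IF layer `d` of
  `ExcursionBudget` holds THEN bounded volume representations `A, B, A', B'` of dimension `d + 2` with
  `vol A − vol B = vol A' − vol B'` satisfy `[A] − [B] − ([A'] − [B']) ∈ relations`. Its
  unconditional all-dimension form is the Cresson–Viu-Sos volume conjecture
  `KZ.volumeConjectureCompact`, summit-EQUIVALENT by the landed
  `KZ.kzPeriodConjecture'_iff_volumeConjectureCompact_holds`, and is NOT used: the stub is one level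
  of it under the layer-`d` hypothesis (it neither gives the summit nor, without the reduction,
  `DimensionStep`; probes in the strategist's bc/DimensionStep_stubprobe.out).
* `stratum_succ_of_layer` (sorry-free implication: stub statements ⟹ `Layer d → Stratum (d+1)`) and
  `DimensionStep_of` (the skeleton: stubs by name ⟹ the route decl by name) — real proof: reduce `r`,
  `r'` to differences of bounded solids in the common dimension `d + 2`, compare volumes by soundness
  (`KZ.relations_le_ker_eval_holds`), apply the volume step under the layer-`d` hypothesis (the route
  decl's inlined truncation is `KZ.relationsLE (d + 1)` by `rfl`), reassemble in the free abelian
  group. Conclusion: literally the route decl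
  `Summit.KontsevichZagierPeriods.KontsevichZagierPeriods.Theses.DessinsDimensionOne.DimensionStep`.

Sources: KontsevichZagier2001 §1.2 (rules, Conjecture 1, Problem 2); ViuSos2021 Thm 1.1 / Cor 2.3;
CressonViusos2022 §1 p. 326 (volume conjecture); tree `KZVolumeConjecture(Proofs).lean`.
-/

namespace Summit.KontsevichZagierPeriods.KontsevichZagierPeriods.Cruxes.DimensionStep.VolumeTransfer

open Literature.NumberTheory.Transcendental
open Summit.KontsevichZagierPeriods.KontsevichZagierPeriods.Theses.DessinsDimensionOne (DimensionStep)

/-- Layer `d` of `ExcursionBudget` (the hypothesis of `DimensionStep d`; the route decl inlines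
`KZ.relationsLE (d + 1)`, equal by `rfl`). -/
def Layer (d : ℕ) : Prop :=
  ∀ ⦃n m : ℕ⦄, n ≤ d → m ≤ d → ∀ (r : KZ.IntegralRep n) (r' : KZ.IntegralRep m),
    r.IsRational → r'.IsRational → r.value = r'.value → KZ.of r - KZ.of r' ∈ KZ.relationsLE (d + 1)

/-- A *bounded volume representation*: bounded domain, integrand `1` on the domain
(the shape produced by `KZ.exists_sub_isBounded`). -/
def IsBoundedVolume {N : ℕ} (s : KZ.IntegralRep N) : Prop :=
  Bornology.IsBounded s.domain ∧ ∀ z ∈ s.domain, s.integrand z = 1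

/-- STUB 1 (bounded volumes in any higher dimension — provable now from `KZ.exists_sub_isBounded` and
unit slabs; size M): every representation of dimension `n` is KZ-equivalent to a difference of two
bounded volume representations of each dimension `N ≥ n + 1`. -/
theorem stub_boundedVolumes : ∀ (n N : ℕ), n + 1 ≤ N → ∀ (r : KZ.IntegralRep n),
    ∃ (A B : KZ.IntegralRep N), IsBoundedVolume A ∧ IsBoundedVolume B ∧
      KZ.of r - (KZ.of A - KZ.of B) ∈ KZ.relations := by
  sorry

/-- STUB 2 (THE OPEN CONTENT — the conditional volume step at level `d + 2`): for `d ≥ 2`, layer `d`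
of `ExcursionBudget` implies that bounded volume representations `A B A' B'` of dimension `d + 2` with
`vol A − vol B = vol A' − vol B'` satisfy `[A] − [B] ≡ [A'] − [B']` modulo the moves. -/
theorem stub_volumeStep : ∀ d : ℕ, 2 ≤ d → Layer d →
    ∀ (A B A' B' : KZ.IntegralRep (d + 2)), IsBoundedVolume A → IsBoundedVolume B →
      IsBoundedVolume A' → IsBoundedVolume B' →
      A.value - B.value = A'.value - B'.value →
      KZ.of A - KZ.of B - (KZ.of A' - KZ.of B') ∈ KZ.relations := by
  sorry

/-- Soundness in value form: a relation evaluates to `0`. -/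
theorem eval_eq_zero_of_mem {c : KZ.FormalRep} (hc : c ∈ KZ.relations) : KZ.eval c = 0 :=
  (AddMonoidHom.mem_ker).mp (KZ.relations_le_ker_eval_holds hc)

/-- Conjecture 1 on the stratum `≤ d` (local abbreviation; the conclusion of `DimensionStep d` is
`Stratum (d + 1)`, by `rfl`). -/
def Stratum (d : ℕ) : Prop :=
  ∀ ⦃n m : ℕ⦄, n ≤ d → m ≤ d → ∀ (r : KZ.IntegralRep n) (r' : KZ.IntegralRep m),
    r.IsRational → r'.IsRational → r.value = r'.value → KZ.Equivalent r r'

/-- THE COMPOSITION AS A SORRY-FREE IMPLICATION (stub statements ⟹ every step): bounded-volume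
reduction + the conditional volume step give `Layer d → Stratum (d + 1)` for `d ≥ 2`. Axioms:
propext / Classical.choice / Quot.sound only. -/
theorem stratum_succ_of_layer
    (h1 : ∀ (n N : ℕ), n + 1 ≤ N → ∀ (r : KZ.IntegralRep n),
      ∃ (A B : KZ.IntegralRep N), IsBoundedVolume A ∧ IsBoundedVolume B ∧
        KZ.of r - (KZ.of A - KZ.of B) ∈ KZ.relations)
    (h2 : ∀ d : ℕ, 2 ≤ d → Layer d →
      ∀ (A B A' B' : KZ.IntegralRep (d + 2)), IsBoundedVolume A → IsBoundedVolume B →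
        IsBoundedVolume A' → IsBoundedVolume B' →
        A.value - B.value = A'.value - B'.value →
        KZ.of A - KZ.of B - (KZ.of A' - KZ.of B') ∈ KZ.relations)
    {d : ℕ} (hd : 2 ≤ d) (hLayer : Layer d) : Stratum (d + 1) := by
  intro n m hn hm r r' _ _ hv
  -- both sides as differences of bounded solids in the common dimension `d + 2`
  obtain ⟨A, B, hA, hB, hrAB⟩ := h1 n (d + 2) (by omega) r
  obtain ⟨A', B', hA', hB', hr'AB⟩ := h1 m (d + 2) (by omega) r'
  -- the volumes agree (soundness of the moves)
  have e1 := eval_eq_zero_of_mem hrAB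
  have e2 := eval_eq_zero_of_mem hr'AB
  simp only [map_sub, KZ.eval_of] at e1 e2
  have hvol : A.value - B.value = A'.value - B'.value := by linarith
  -- the conditional volume step, under the layer-`d` hypothesis
  have hstep : KZ.of A - KZ.of B - (KZ.of A' - KZ.of B') ∈ KZ.relations :=
    h2 d hd hLayer A B A' B' hA hB hA' hB' hvol
  -- reassemble `[r] − [r']`
  have e : KZ.of r - KZ.of r' =
      (KZ.of r - (KZ.of A - KZ.of B)) - (KZ.of r' - (KZ.of A' - KZ.of B'))
        + (KZ.of A - KZ.of B - (KZ.of A' - KZ.of B')) := by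
    abel
  show KZ.of r - KZ.of r' ∈ KZ.relations
  rw [e]
  exact add_mem (sub_mem hrAB hr'AB) hstep

/-- THE SKELETON (concludes the route decl BY NAME from the two stubs BY NAME): the inlined
layer-`d` hypothesis of the route decl is `Layer d` and its conclusion is `Stratum (d + 1)`. -/
theorem DimensionStep_of : DimensionStep := by
  intro d hd hL n m hn hm r r' hr hr' hv
  have hLayer : Layer d := fun n m hn hm r r' hr hr' hv => hL hn hm r r' hr hr' hv
  exact stratum_succ_of_layer stub_boundedVolumes stub_volumeStep hd hLayer hn hm r r' hr hr' hv

end Summit.KontsevichZagierPeriods.KontsevichZagierPeriods.Cruxes.DimensionStep.VolumeTransfer
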